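import Literature.Barriers.CriticalPhenomena.TimarCutTransport
import Mathlib.MeasureTheory.Integral.Lebesgue.Countable
import HarnessLib

/-!
# The cut route to Timár 2006, Thm. 5.5: a pointing forest of out-degree `≥ 3` on finite classes
# admits no exhaustion — PROVED (abstract form)

Barrier catalogue `Literature/Barriers/CriticalPhenomena/`; a brick of the programme proving
Timár's Thm. 5.5 (`Timar2006_finiteLevelUnion`, `TimarCriticalNonunimodular.lean`), continuing
`TimarCutTransport.lean`. Á. Timár, *Percolation on nonunimodular transitive graphs*, Ann. Probab.
34 (2006) 2344–2364, end of the proof of Thm. 5.5 (p. 2360):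

> "On the other hand, it has an equivariant exhaustion `R_i` by graphs of only finite components,
> for the following reason. Consider the invariant exhaustion `P_i` of the set of levels of `G` by
> finite partitions, as in Proposition 5.4. … By our assumption, every `ω_A` has only finite
> components. Now, define `R_i` to be the partition that the `ω_A`'s induce on the vertices …
> the sequence `(R_i)_i` exhausts `Φ` because any set of finitely many levels of `G` is contained
> in the same class of `P_i` with probability tending to 1 and hence the endpoints of any edge of
> `Φ` are in the same component of `R_i` with probability tending to 1. This contradicts …"

On the printed route the contradiction is between two expected degrees (Lemma 5.1 along the
exhaustion versus the bags; the tree's `TimarExhaustionBound.lean`). This file PROVES the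
contradiction of the CUT route (`TimarCutTransport.lean`), in the abstract invariant-space setting
of `TimarMassTransport.lean` (a finite measure `μ` on `Ω` preserved by measurable maps `act γ`,
`γ ∈ Aut(G)`, `G` connected, locally finite, transitive, weights `w = autWeight G o`):

* the data are an equivariant measurable vertex set `D` (the points of the forest), pointing
  relation `P` (Timár's `M⃗`: "`v` points to the closest point of each branch") and, for every
  stage `i`, classes `cls i` (the traces on `D` of the components of the `ω_A`, `A ∈ P_i`, inside
  a class of the 1-partition);
* hypotheses, all almost sure: the classes through points of `D` partition `D`, are FINITE (the
  standing assumption "all connected components in `C ∩ L` are finite") and carry the weight bound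
  `w(x) ≤ B w(y)` (`B = μ` inside a class of the 1-partition); the undirected pointing graph
  (`pointGraph`, Timár's `M`) is acyclic, every point of `D` points to at least `3` and at most
  `N` targets ("every point `x` in `F` has degree `≥ 3`"; `N` = the degree of `G`); and the
  exhaustion "`P(x → t and t ∉ cls_i(x)) → 0` for all `x, t`" (from Prop. 5.4 as in the display);
* conclusion (`measure_mem_eq_zero_of_cut_exhaustion`): **`P(x ∈ D) = 0` for every vertex `x`** —
  the forest is almost surely empty. Proof: by `measure_le_mul_lintegral_cut` and the deficit
  `card_add_two_le_sum_encard_cut`, `P(x ∈ D) ≤ B · E[cut_i(x)]` for every `i`, where `cut_i(x)`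
  counts the out-edges of `x` leaving `cls_i(x)`; and `E[cut_i(x)] = Σ_t P(x → t, t ∉ cls_i(x)) → 0`
  by dominated convergence (`E[#targets] ≤ N`).

In the proof of Thm. 5.5 this is applied with `D` = the encounter points of the bad heavy
clusters, which has positive probability if bad heavy clusters exist — the contradiction.

## References

* Á. Timár, Ann. Probab. 34 (2006) 2344–2364 (arXiv:math/0702875), §5: proof of Thm. 5.5 (the
  forest, degrees `≥ 3`, the exhaustion `R_i` and Prop. 5.4, the final contradiction). [Timar2006]
* R. Lyons, Y. Peres, *Probability on Trees and Networks*, CUP 2016, Exercise 7.3, §8.2 ((8.10)).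
  [LyonsPeres2016]
-/

noncomputable section

namespace Literature.Barriers.CriticalPhenomena

open _root_.MeasureTheory _root_.Filter Literature.Probability.Percolation SimpleGraph Finset
open scoped ENNReal Topology

variable {V : Type*}

/-! ### The pointing graph and the cut count -/

/-- **The pointing graph** of a pointing relation `P` ("Denote by `M` the graph that results
from ignoring the directions of the edges in `M⃗`"). [cite: Timar2006, Thm. 5.5 (proof: the graph M)] -/
def pointGraph (P : V → V → Prop) : SimpleGraph V where
  Adj a b := a ≠ b ∧ (P a b ∨ P b a)
  symm := ⟨fun _ _ h => ⟨h.1.symm, h.2.symm⟩⟩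
  loopless := ⟨fun _ h => h.1 rfl⟩

/-- **The cut count** of `x` relative to a class `Q`: the number of targets of `x` outside `Q`.
[cite: Timar2006, Thm. 5.5 (proof: edges of Φ whose endpoints are not in one component of R_i)] -/
def cutCount (P : V → V → Prop) (Q : Set V) (x : V) : ℝ≥0∞ :=
  (({t | P x t ∧ t ∉ Q} : Set V).encard : ℝ≥0∞)

/-- **The deficit in `[0, ∞]`-form**: for a finite nonempty class `Q` all of whose points have at
least `3` targets, in an acyclic pointing graph, `|Q| ≤ Σ_{y ∈ Q} cut_Q(y)`
(`card_add_two_le_sum_encard_cut`). [cite: Timar2006, Thm. 5.5 (proof: degrees ≥ 3 in the forest)] [cite: LyonsPeres2016, Exercise 7.3] -/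
theorem encard_le_tsum_indicator_cutCount {P : V → V → Prop} (hacyc : (pointGraph P).IsAcyclic)
    (hne : ∀ a b, P a b → a ≠ b) {Q : Set V} (hQ : Q.Finite) (hQne : Q.Nonempty)
    (h3 : ∀ y ∈ Q, 3 ≤ ({t | P y t} : Set V).encard) :
    (Q.encard : ℝ≥0∞) ≤ ∑' y, Q.indicator (cutCount P Q) y := by
  classical
  set F := hQ.toFinset with hF
  have hFQ : (↑F : Set V) = Q := hQ.coe_toFinset
  have hFne : F.Nonempty := by
    obtain ⟨y, hy⟩ := hQne
    exact ⟨y, hQ.mem_toFinset.2 hy⟩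
  have hdef := card_add_two_le_sum_encard_cut hacyc (Pt := P)
    (fun a b h => ⟨hne a b h, Or.inl h⟩) F hFne (fun y hy => h3 y (hQ.mem_toFinset.1 hy))
  -- rewrite both sides
  have hL : (Q.encard : ℝ≥0∞) = ((#F : ℕ∞) : ℝ≥0∞) := by
    rw [← hFQ, Set.encard_coe_eq_coe_finsetCard]
  have hR : ∑' y, Q.indicator (cutCount P Q) y =
      ∑ y ∈ F, ((({t | P y t ∧ t ∉ F} : Set V).encard : ℕ∞) : ℝ≥0∞) := by
    rw [tsum_eq_sum (s := F) fun y hy => Set.indicator_of_notMem (fun h => hy (hQ.mem_toFinset.2 h)) _]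
    refine sum_congr rfl fun y hy => ?_
    rw [Set.indicator_of_mem (hQ.mem_toFinset.1 hy), cutCount]
    congr 2
    ext t
    simp only [Set.mem_setOf_eq, ← hFQ, Finset.mem_coe]
  have hsum : (((∑ y ∈ F, ({t | P y t ∧ t ∉ F} : Set V).encard : ℕ∞)) : ℝ≥0∞) =
      ∑ y ∈ F, ((({t | P y t ∧ t ∉ F} : Set V).encard : ℕ∞) : ℝ≥0∞) := by
    exact map_sum ENat.toENNRealRingHom (fun y => ({t | P y t ∧ t ∉ F} : Set V).encard) F
  rw [hL, hR, ← hsum, ENat.toENNReal_le]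
  exact le_trans le_self_add hdef

/-! ### The abstract contradiction -/

section Invariant

variable {Ω : Type*} [MeasurableSpace Ω] {G : SimpleGraph V} [G.LocallyFinite]

/-- **A series of measures dominated by a summable one and tending to zero termwise tends to
zero** (dominated convergence for the counting measure). [folklore] -/
theorem tendsto_tsum_measure_of_dominated [Countable V] {F : ℕ → V → ℝ≥0∞} {g : V → ℝ≥0∞}
    (hle : ∀ i t, F i t ≤ g t) (hg : ∑' t, g t ≠ ⊤)
    (hlim : ∀ t, Tendsto (fun i => F i t) atTop (𝓝 0)) :
    Tendsto (fun i => ∑' t, F i t) atTop (𝓝 0) := by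
  letI : MeasurableSpace V := ⊤
  haveI : MeasurableSingletonClass V := ⟨fun _ => MeasurableSpace.measurableSet_top⟩
  have h := tendsto_lintegral_of_dominated_convergence (μ := Measure.count) g
    (F := F) (f := fun _ => 0) (fun i => measurable_from_top)
    (fun i => Eventually.of_forall fun t => hle i t) (by rwa [lintegral_count]) 
    (Eventually.of_forall fun t => hlim t)
  simp only [lintegral_count, lintegral_zero] at h
  simpa only [lintegral_count] using h

/-- **The cut route to Thm. 5.5: no exhaustion of a pointing forest of out-degree `≥ 3` on finite
classes, PROVED (abstract form).** See the module docstring for the statement; in words: if the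
points `D` of an equivariant pointing forest (acyclic, `3 ≤ #targets ≤ N` at every point of `D`)
are partitioned at every stage `i` into finite classes with the weight bound `w(x) ≤ B w(y)`,
`B < ∞`, and every out-edge is eventually inside the class of its tail in probability, then
`P(x ∈ D) = 0` for every vertex `x`.
[cite: Timar2006, Thm. 5.5 (proof: the exhaustion R_i and the final contradiction)] -/
theorem measure_mem_eq_zero_of_cut_exhaustion (hconn : G.Connected) (ht : IsGraphTransitive G)
    (μ : Measure Ω) [IsFiniteMeasure μ] (act : (G ≃g G) → Ω → Ω) (hact : ∀ γ, Measurable (act γ))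
    (hμ : ∀ γ, μ.map (act γ) = μ) {D : Ω → Set V} {P : Ω → V → V → Prop}
    {cls : ℕ → Ω → V → Set V} (hDm : ∀ x, MeasurableSet {ξ | x ∈ D ξ})
    (hPm : ∀ x t, MeasurableSet {ξ | P ξ x t})
    (hclsm : ∀ i x y, MeasurableSet {ξ | y ∈ cls i ξ x})
    (hDinv : ∀ γ ξ x, γ x ∈ D (act γ ξ) ↔ x ∈ D ξ)
    (hPinv : ∀ γ ξ x t, P (act γ ξ) (γ x) (γ t) ↔ P ξ x t)
    (hclsinv : ∀ i γ ξ x y, γ y ∈ cls i (act γ ξ) (γ x) ↔ y ∈ cls i ξ x) (o : V) {B : ℝ≥0∞}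
    (hBT : B ≠ ⊤) (N : ℕ)
    (hcls : ∀ᵐ ξ ∂μ, ∀ i, ∀ x ∈ D ξ, x ∈ cls i ξ x ∧ cls i ξ x ⊆ D ξ ∧
      (∀ y ∈ cls i ξ x, cls i ξ y = cls i ξ x) ∧ (cls i ξ x).Finite ∧
      ∀ y ∈ cls i ξ x, autWeight G o x ≤ B * autWeight G o y)
    (hforest : ∀ᵐ ξ ∂μ, (pointGraph (P ξ)).IsAcyclic ∧ (∀ a b, P ξ a b → a ≠ b) ∧
      (∀ x ∈ D ξ, 3 ≤ ({t | P ξ x t} : Set V).encard) ∧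
      ∀ x, ({t | P ξ x t} : Set V).encard ≤ N)
    (hexh : ∀ x t, Tendsto (fun i => μ {ξ | P ξ x t ∧ t ∉ cls i ξ x}) atTop (𝓝 0)) (x : V) :
    μ {ξ | x ∈ D ξ} = 0 := by
  classical
  haveI : Countable V := countable_of_connected_of_locallyFinite G hconn o
  -- the cut counts
  set cut : ℕ → Ω → V → ℝ≥0∞ := fun i ξ y =>
    (({t | P ξ y t ∧ t ∉ cls i ξ y} : Set V).encard : ℝ≥0∞) with hcut
  have hcut_tsum : ∀ i ξ y, cut i ξ y = ∑' t, ({t | P ξ y t ∧ t ∉ cls i ξ y} : Set V).indicator 1 t := by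
    intro i ξ y
    rw [show (1 : V → ℝ≥0∞) = fun _ => 1 from rfl, tsum_indicator_const, mul_one]
  have hEm : ∀ i y t, MeasurableSet {ξ | P ξ y t ∧ t ∉ cls i ξ y} := fun i y t =>
    (hPm y t).inter (hclsm i y t).compl
  have hcutm : ∀ i y, Measurable fun ξ => cut i ξ y := by
    intro i y
    simp_rw [hcut_tsum]
    refine measurable_tsum_ennreal fun t => measurable_one.indicator ?_
    exact hEm i y t
  have hcutinv : ∀ i γ ξ y, cut i (act γ ξ) (γ y) = cut i ξ y := by
    intro i γ ξ y
    have hset : ({t | P (act γ ξ) (γ y) t ∧ t ∉ cls i (act γ ξ) (γ y)} : Set V) =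
        (γ : V → V) '' {t | P ξ y t ∧ t ∉ cls i ξ y} := by
      ext t
      constructor
      · intro h
        refine ⟨γ.symm t, ?_, γ.apply_symm_apply t⟩
        have h' := h
        rw [← γ.apply_symm_apply t] at h'
        exact ⟨(hPinv γ ξ y _).1 h'.1, fun hm => h'.2 ((hclsinv i γ ξ y _).2 hm)⟩
      · rintro ⟨t', ht', rfl⟩
        exact ⟨(hPinv γ ξ y t').2 ht'.1, fun hm => ht'.2 ((hclsinv i γ ξ y t').1 hm)⟩
    simp only [hcut]
    rw [hset, γ.injective.encard_image]
  -- Step A: `P(x ∈ D) ≤ B · E[cut_i(x); x ∈ D]`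
  have hgood : ∀ i, ∀ᵐ ξ ∂μ, ∀ y ∈ D ξ, y ∈ cls i ξ y ∧ cls i ξ y ⊆ D ξ ∧
      (∀ z ∈ cls i ξ y, cls i ξ z = cls i ξ y) ∧ (cls i ξ y).Finite ∧
      (∀ z ∈ cls i ξ y, autWeight G o y ≤ B * autWeight G o z) ∧
      ((cls i ξ y).encard : ℝ≥0∞) ≤ ∑' z, (cls i ξ y).indicator (cut i ξ) z := by
    intro i
    filter_upwards [hcls, hforest] with ξ h1 h2 y hy
    obtain ⟨hyy, hsub, hpart, hfin, htilt⟩ := h1 i y hy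
    refine ⟨hyy, hsub, hpart, hfin, htilt, ?_⟩
    have hdef := encard_le_tsum_indicator_cutCount h2.1 h2.2.1 hfin ⟨y, hyy⟩
      (fun z hz => h2.2.2.1 z (hsub hz))
    refine hdef.trans (le_of_eq (tsum_congr fun z => ?_))
    by_cases hz : z ∈ cls i ξ y
    · rw [Set.indicator_of_mem hz, Set.indicator_of_mem hz]
      simp only [cutCount, hcut]
      rw [hpart z hz]
    · rw [Set.indicator_of_notMem hz, Set.indicator_of_notMem hz]
  have hA : ∀ i, μ {ξ | x ∈ D ξ} ≤ B * ∫⁻ ξ, cut i ξ x ∂μ := by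
    intro i
    refine (measure_le_mul_lintegral_cut hconn ht μ act hact hμ hDm (hclsm i) (hcutm i) hDinv
      (hclsinv i) (hcutinv i) o (hgood i) x).trans ?_
    exact mul_le_mul' le_rfl (lintegral_mono fun ξ => Set.indicator_le_self _ _ ξ)
  -- Step B: `E[cut_i(x)] = Σ_t P(x → t, t ∉ cls_i(x)) → 0`
  have hcut_ind : ∀ i ξ y, cut i ξ y =
      ∑' t, ({ξ' | P ξ' y t ∧ t ∉ cls i ξ' y} : Set Ω).indicator (1 : Ω → ℝ≥0∞) ξ := by
    intro i ξ y
    rw [hcut_tsum]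
    refine tsum_congr fun t => ?_
    simp only [Set.indicator_apply, Set.mem_setOf_eq, Pi.one_apply]
  have hint : ∀ i, ∫⁻ ξ, cut i ξ x ∂μ = ∑' t, μ {ξ | P ξ x t ∧ t ∉ cls i ξ x} := by
    intro i
    rw [lintegral_congr fun ξ => hcut_ind i ξ x,
      lintegral_tsum fun t => (measurable_one.indicator (hEm i x t)).aemeasurable]
    exact tsum_congr fun t => lintegral_indicator_one (hEm i x t)
  have hbound : ∑' t, μ {ξ | P ξ x t} ≠ ⊤ := by
    have h2 : ∀ ξ, (({t | P ξ x t} : Set V).encard : ℝ≥0∞) =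
        ∑' t, ({ξ' | P ξ' x t} : Set Ω).indicator (1 : Ω → ℝ≥0∞) ξ := by
      intro ξ
      rw [show (({t | P ξ x t} : Set V).encard : ℝ≥0∞) = ∑' t, ({t | P ξ x t} : Set V).indicator 1 t by
        rw [show (1 : V → ℝ≥0∞) = fun _ => 1 from rfl, tsum_indicator_const, mul_one]]
      refine tsum_congr fun t => ?_
      simp only [Set.indicator_apply, Set.mem_setOf_eq, Pi.one_apply]
    have h1 : ∑' t, μ {ξ | P ξ x t} = ∫⁻ ξ, (({t | P ξ x t} : Set V).encard : ℝ≥0∞) ∂μ := by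
      rw [lintegral_congr fun ξ => h2 ξ,
        lintegral_tsum fun t => (measurable_one.indicator (hPm x t)).aemeasurable]
      exact (tsum_congr fun t => lintegral_indicator_one (hPm x t)).symm
    rw [h1]
    refine ne_top_of_le_ne_top (ENNReal.mul_ne_top (ENNReal.natCast_ne_top N) (measure_ne_top μ Set.univ)) ?_
    calc ∫⁻ ξ, (({t | P ξ x t} : Set V).encard : ℝ≥0∞) ∂μ ≤ ∫⁻ _ξ, (N : ℝ≥0∞) ∂μ := by
          refine lintegral_mono_ae ?_
          filter_upwards [hforest] with ξ hξ
          exact_mod_cast hξ.2.2.2 x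
      _ = N * μ Set.univ := lintegral_const _
  have hB : Tendsto (fun i => ∫⁻ ξ, cut i ξ x ∂μ) atTop (𝓝 0) := by
    simp_rw [hint]
    exact tendsto_tsum_measure_of_dominated (fun i t => measure_mono fun ξ hξ => hξ.1) hbound
      (hexh x)
  -- Step C
  have hlim : Tendsto (fun i => B * ∫⁻ ξ, cut i ξ x ∂μ) atTop (𝓝 0) := by
    simpa only [mul_zero] using ENNReal.Tendsto.const_mul hB (Or.inr hBT)
  exact le_zero_iff.1 (ge_of_tendsto' hlim hA)

end Invariant

end Literature.Barriers.CriticalPhenomena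

end
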